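import Literature.AnabelianGeometry.SemiGraphs.InterfaceVocab
import Literature.AnabelianGeometry.SemiGraphs.TemperedCurves

/-!
# Kernel DAG index — layer L3, part u (abc-iut-dag's MACHINE DELTA-DRAFT plan/kernel-draft/DAGL3s.lean @03:00Z, deduplicated against the tree by abc-iut-c312-2 and re-lettered; encoding as in c312-2's generated parts @2026-08-26T03:05Z from HOME/plan/DAG.tsv +
KERNEL-DAG-MODULES.tsv (regenerated 2026-08-26T02:58:29Z): 2 landed/discharged nodes NOT YET in the tree index Summits/ABC/IUTFork/DAG*.lean; spec v1.3 §2 (M))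

THIS FILE PROVES NOTHING NEW AND ASSERTS NOTHING (HOME/plan/KERNEL-DAG-SPEC.md). It gives ONE NAME `N_<kernel_id>` to each DAG node whose
statement has LANDED through the gate, knitting the landed declarations BY NAME: claim nodes `N_<id> : Prop := StatementOf @thm₁ ∧ …` (one
conjunct per landed theorem the DAG row names, universe levels instantiated explicitly per the spec's UNIVERSE RULE, arities read off the farm),
witnessed `N_<id>_holds` iff the DAG row is `discharged(p…)` and `N_<id>_part` otherwise (spec §2(b),(c); c312-2 F1/F2); data nodes
`abbrev N_<id> := @<primary>` with the row's further declarations as `example := @…` lines; FACT-style `def … : Prop` declarations are data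
here (a NAME, never asserted). Decl lists come from the `decls` column of plan/DAG.tsv as resolved against the tree sources (unresolvable
tokens dropped and reported to abc-iut-dag on STATUS). Nothing here says abc is proved or refuted or takes a side on [IUTchIII] Cor 3.12.
typed ≠ discharged; indexed ≠ endorsed.
-/

namespace Summit.ABC.IUTFork.DAG

namespace PartL3u
/-- `StatementOf h` is the statement (a `Prop`) of which the landed `h` is the proof: the index NAMES statements, it never re-types them. -/
abbrev StatementOf {P : Prop} (_h : P) : Prop := P
end PartL3u
open PartL3u

noncomputable section
universe u₁ u₂ u₃ u₄ u₅ u₆ u₇ u₈ u₉ u₁₀ u₁₁ u₁₂ u₁₃ u₁₄ u₁₅ u₁₆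

/-- [node L3:TemperedCurveInterface · L3/D1 · [L3] INTERFACE structures `TemperedArithmeticGroup K` / `OncePuncturedTemperedGroup K` (NAMES … · p405241 · claim · DAG status discharged(p405241)] decls 14 · cites→ - -/
def N_L3_TemperedCurveInterface : Prop :=
  StatementOf @Literature.AnabelianGeometry.SemiGraphs.TemperedArithmeticGroup.delta_normal.{u₁} ∧
  StatementOf @Literature.AnabelianGeometry.SemiGraphs.TemperedArithmeticGroup.mem_delta_iff.{u₁} ∧
  StatementOf @Literature.AnabelianGeometry.SemiGraphs.OncePuncturedTemperedGroup.isClosed_deltaHat.{u₁} ∧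
  StatementOf @Literature.AnabelianGeometry.SemiGraphs.OncePuncturedTemperedGroup.deltaHat_eq_ker_augHat.{u₁} ∧
  StatementOf @Literature.AnabelianGeometry.SemiGraphs.OncePuncturedTemperedGroup.deltaHat_normal.{u₁} ∧
  StatementOf @Literature.AnabelianGeometry.SemiGraphs.OncePuncturedTemperedGroup.comap_toHat_deltaHat.{u₁} ∧
  StatementOf @Literature.AnabelianGeometry.SemiGraphs.OncePuncturedTemperedGroup.conj_toHat_mem_deltaHat.{u₁}
/-- discharge of `N_L3_TemperedCurveInterface`: the landed theorems it names, BY NAME (spec §2(c)); proves nothing new. -/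
theorem N_L3_TemperedCurveInterface_holds : N_L3_TemperedCurveInterface := ⟨@Literature.AnabelianGeometry.SemiGraphs.TemperedArithmeticGroup.delta_normal, @Literature.AnabelianGeometry.SemiGraphs.TemperedArithmeticGroup.mem_delta_iff, @Literature.AnabelianGeometry.SemiGraphs.OncePuncturedTemperedGroup.isClosed_deltaHat, @Literature.AnabelianGeometry.SemiGraphs.OncePuncturedTemperedGroup.deltaHat_eq_ker_augHat, @Literature.AnabelianGeometry.SemiGraphs.OncePuncturedTemperedGroup.deltaHat_normal, @Literature.AnabelianGeometry.SemiGraphs.OncePuncturedTemperedGroup.comap_toHat_deltaHat, @Literature.AnabelianGeometry.SemiGraphs.OncePuncturedTemperedGroup.conj_toHat_mem_deltaHat⟩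
example := @Literature.AnabelianGeometry.SemiGraphs.IsFreeProfiniteOn.{u₁, u₂}
example := @Literature.AnabelianGeometry.SemiGraphs.TemperedArithmeticGroup.{u₁}
example := @Literature.AnabelianGeometry.SemiGraphs.TemperedArithmeticGroup.delta.{u₁}
example := @Literature.AnabelianGeometry.SemiGraphs.TemperedArithmeticGroup.quotientDeltaEquiv.{u₁}
example := @Literature.AnabelianGeometry.SemiGraphs.OncePuncturedTemperedGroup.{u₁}
example := @Literature.AnabelianGeometry.SemiGraphs.OncePuncturedTemperedGroup.deltaHat.{u₁}

/-- [node L3:VocabContainer§1–3 · L3/D1 · [L3] STUB-CONTAINER `SemiAnbdVocab (Obj) [Category Obj]` = the §§1–3 vocabulary §4/§5 are typed … · p403787 · claim · DAG status discharged(p403787)] decls 24 · cites→ - -/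
def N_L3_VocabContainerS1_3 : Prop :=
  StatementOf @Literature.AnabelianGeometry.SemiGraphs.SemiAnbdVocab.isLocallyFiniteEtale_id.{u₁, u₂, u₃} ∧
  StatementOf @Literature.AnabelianGeometry.SemiGraphs.SemiAnbdVocab.isLocallyFiniteEtale_ιV.{u₁, u₂, u₃} ∧
  StatementOf @Literature.AnabelianGeometry.SemiGraphs.SemiAnbdVocab.isLocallyFiniteEtale_ιE.{u₁, u₂, u₃}
/-- discharge of `N_L3_VocabContainerS1_3`: the landed theorems it names, BY NAME (spec §2(c)); proves nothing new. -/
theorem N_L3_VocabContainerS1_3_holds : N_L3_VocabContainerS1_3 := ⟨@Literature.AnabelianGeometry.SemiGraphs.SemiAnbdVocab.isLocallyFiniteEtale_id, @Literature.AnabelianGeometry.SemiGraphs.SemiAnbdVocab.isLocallyFiniteEtale_ιV, @Literature.AnabelianGeometry.SemiGraphs.SemiAnbdVocab.isLocallyFiniteEtale_ιE⟩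
example := @Literature.AnabelianGeometry.SemiGraphs.SemiAnbdVocab.{u₁, u₂, u₃}
example := @Literature.AnabelianGeometry.SemiGraphs.SemiAnbdVocab.vertCard.{u₁, u₂, u₃}
example := @Literature.AnabelianGeometry.SemiGraphs.SemiAnbdVocab.IsClosedEdge.{u₁, u₂, u₃}
example := @Literature.AnabelianGeometry.SemiGraphs.SemiAnbdVocab.IsOpenEdge.{u₁, u₂, u₃}
example := @Literature.AnabelianGeometry.SemiGraphs.SemiAnbdVocab.IsIsolatedEdge.{u₁, u₂, u₃}
example := @Literature.AnabelianGeometry.SemiGraphs.SemiAnbdVocab.BrAt.{u₁, u₂, u₃}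

end

end Summit.ABC.IUTFork.DAG
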